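import Summits.Langlands.Langlands.Theorems.ParityBlindBianchiArtinWeightRealisationEvenStubScalarOnProjectiveKernel
import HarnessLib

/-!
# Stub `stub_twistConjugateOfSignedTraces` (S4b) of the line `SketchIdeator2` for the crux
# `ParityBlindBianchi.ArtinWeightRealisationEven` (item stmt-Langlands-16619) — part 1/3:
# `2 × 2` linear algebra

Helper file (`--supports stmt-Langlands-16619`) for the pinning core S4b (see part 3/3,
`…StubTwistConjugateOfSignedTraces.lean`, for the statement and the proof plan).  Generic lemmas
on `2 × 2` matrices over a field: a unipotent element of finite order is trivial; explicit
diagonalisation of a matrix with two distinct eigenvalues; the "antidiagonal" lemma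
(`D X D = c X` forces `X` antidiagonal); rescaling by `diag(1, t)`; the Vandermonde sign lemma
(`l₁ⁱ u + l₂ⁱ v = ± (l₁ⁱ u₀ + l₂ⁱ v₀)`, `i = 0, 1, 2` ⇒ `(u, v) = ± (u₀, v₀)`); trace formulas in the
normal form; conjugation bookkeeping.  No definition, no named fact.
-/

-- the line's namespace `Summit.Langlands.Langlands.…` (summit = problem = `Langlands`) repeats a
-- component by design
set_option linter.dupNamespace false

namespace Summit.Langlands.Langlands.Theorems.ArtinWeightRealisationEven

open scoped MatrixGroups Matrix
open Literature.NumberTheory.EllipticCurves.DeuringLadic (Matrix.sq_eq_trace_smul_sub_det_fin_two)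
open Literature.NumberTheory.EllipticCurves.Hida2000Thm326 (one_add_pow_of_mul_self_eq_zero)

universe u v

namespace TwistConjugate

variable {A : Type*} [Field A]

/-! ### Generic `2 × 2` linear algebra -/

/-- A `2 × 2` matrix of finite order with `(S - l)² = 0`, `l ≠ 0`, over a field of characteristic
`0` is the scalar `l` (a unipotent element of finite order is trivial). -/
theorem eq_smul_one_of_sq_eq_zero_of_pow_eq_one [CharZero A] {S : Matrix (Fin 2) (Fin 2) A}
    {l : A} (hl : l ≠ 0) (h : (S - l • 1) * (S - l • 1) = 0) {m : ℕ} (hm : 0 < m)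
    (hS : S ^ m = 1) : S = l • 1 := by
  set n : Matrix (Fin 2) (Fin 2) A := l⁻¹ • (S - l • 1) with hn
  have hSn : S = l • (1 + n) := by
    rw [hn, smul_add, smul_smul, mul_inv_cancel₀ hl, one_smul]
    abel
  have hn2 : n * n = 0 := by
    rw [hn, Matrix.smul_mul, Matrix.mul_smul, h, smul_zero, smul_zero]
  have hpow : S ^ m = l ^ m • (1 + (m : A) • n) := by
    rw [hSn, smul_pow, one_add_pow_of_mul_self_eq_zero hn2, Nat.cast_smul_eq_nsmul]
  have key : (l ^ m - 1) • n = 0 := by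
    have h1 : n * S ^ m = n := by rw [hS, Matrix.mul_one]
    rw [hpow, Matrix.mul_smul, Matrix.mul_add, Matrix.mul_one, Matrix.mul_smul, hn2, smul_zero,
      add_zero] at h1
    rw [sub_smul, one_smul, h1, sub_self]
  have hn0 : n = 0 := by
    rcases smul_eq_zero.mp key with h1 | h1
    · rw [sub_eq_zero] at h1
      rw [h1, one_smul, ← hS, left_eq_add] at hpow
      refine (smul_eq_zero.mp hpow).resolve_left ?_
      exact_mod_cast hm.ne'
    · exact h1
  rw [hSn, hn0, add_zero]

/-- Diagonalisation of a `2 × 2` matrix with two distinct eigenvalues `l₁ ≠ l₂` (given through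
`tr S = l₁ + l₂`, `det S = l₁ l₂`): `S P = P · diag(l₁, l₂)` for an invertible `P` whose columns are
explicit eigenvectors (columns of `S - l₂` and `S - l₁`). -/
theorem exists_mul_eq_mul_diagonal {S : Matrix (Fin 2) (Fin 2) A} {l₁ l₂ : A} (hne : l₁ ≠ l₂)
    (htr : S.trace = l₁ + l₂) (hdet : S.det = l₁ * l₂) :
    ∃ P : GL (Fin 2) A, S * (P : Matrix (Fin 2) (Fin 2) A) =
      (P : Matrix (Fin 2) (Fin 2) A) * !![l₁, 0; 0, l₂] := by
  rw [Matrix.trace_fin_two] at htr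
  rw [Matrix.det_fin_two] at hdet
  by_cases hp : S 0 0 = l₁
  · -- columns: column 0 of `S - l₂` and column 1 of `S - l₁`
    have hd : (!![S 0 0 - l₂, S 0 1; S 1 0, S 1 1 - l₁] : Matrix (Fin 2) (Fin 2) A).det ≠ 0 := by
      rw [Matrix.det_fin_two_of]
      have e : (S 0 0 - l₂) * (S 1 1 - l₁) - S 0 1 * S 1 0 = (l₁ - l₂) * (l₂ - S 0 0) := by
        linear_combination hdet - l₂ * htr
      rw [e]
      exact mul_ne_zero (sub_ne_zero.mpr hne) (sub_ne_zero.mpr (by rw [hp]; exact hne.symm))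
    refine ⟨Matrix.GeneralLinearGroup.mkOfDetNeZero _ hd, ?_⟩
    simp only [Matrix.GeneralLinearGroup.val_mkOfDetNeZero]
    ext i j
    fin_cases i <;> fin_cases j <;> simp [Matrix.mul_apply, Fin.sum_univ_two]
    · linear_combination (S 0 0) * htr - hdet
    · linear_combination (S 0 1) * htr
    · linear_combination (S 1 0) * htr
    · linear_combination (S 1 1) * htr - hdet
  · -- columns: column 1 of `S - l₂` and column 0 of `S - l₁`
    have hd : (!![S 0 1, S 0 0 - l₁; S 1 1 - l₂, S 1 0] : Matrix (Fin 2) (Fin 2) A).det ≠ 0 := by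
      rw [Matrix.det_fin_two_of]
      have e : S 0 1 * S 1 0 - (S 0 0 - l₁) * (S 1 1 - l₂) = (l₂ - l₁) * (S 0 0 - l₁) := by
        linear_combination l₁ * htr - hdet
      rw [e]
      exact mul_ne_zero (sub_ne_zero.mpr hne.symm) (sub_ne_zero.mpr hp)
    refine ⟨Matrix.GeneralLinearGroup.mkOfDetNeZero _ hd, ?_⟩
    simp only [Matrix.GeneralLinearGroup.val_mkOfDetNeZero]
    ext i j
    fin_cases i <;> fin_cases j <;> simp [Matrix.mul_apply, Fin.sum_univ_two]
    · linear_combination (S 0 1) * htr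
    · linear_combination (S 0 0) * htr - hdet
    · linear_combination (S 1 1) * htr - hdet
    · linear_combination (S 1 0) * htr

/-- From `S P = P D` to `P⁻¹ S P = D`. -/
theorem inv_mul_mul_eq_of_mul_eq_mul {S D : Matrix (Fin 2) (Fin 2) A} {P : GL (Fin 2) A}
    (h : S * (P : Matrix (Fin 2) (Fin 2) A) = (P : Matrix (Fin 2) (Fin 2) A) * D) :
    ((P⁻¹ : GL (Fin 2) A) : Matrix (Fin 2) (Fin 2) A) * S * P = D := by
  rw [Matrix.mul_assoc, h, ← Matrix.mul_assoc, ← Units.val_mul, inv_mul_cancel, Units.val_one,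
    Matrix.one_mul]

/-- If `D X D = c X` for `D = diag(l₁, l₂)` with `l₁, l₂ ≠ 0`, `l₁ ≠ l₂`, `l₁² ≠ l₂²` and `X`
invertible, then `X` is antidiagonal. -/
theorem antidiag_of_diag_mul_mul_diag {l₁ l₂ c : A} {X : Matrix (Fin 2) (Fin 2) A}
    (h : !![l₁, 0; 0, l₂] * X * !![l₁, 0; 0, l₂] = c • X) (hX : X.det ≠ 0)
    (h1 : l₁ ≠ 0) (h2 : l₂ ≠ 0) (hne : l₁ ≠ l₂) (hsq : l₁ ^ 2 ≠ l₂ ^ 2) :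
    X 0 0 = 0 ∧ X 1 1 = 0 := by
  have e00 : (l₁ * l₁ - c) * X 0 0 = 0 := by
    have := congr_fun (congr_fun h 0) 0
    simp [Matrix.mul_apply, Fin.sum_univ_two, Matrix.vecMul, dotProduct] at this
    linear_combination this
  have e01 : (l₁ * l₂ - c) * X 0 1 = 0 := by
    have := congr_fun (congr_fun h 0) 1
    simp [Matrix.mul_apply, Fin.sum_univ_two, Matrix.vecMul, dotProduct] at this
    linear_combination this
  have e10 : (l₁ * l₂ - c) * X 1 0 = 0 := by
    have := congr_fun (congr_fun h 1) 0
    simp [Matrix.mul_apply, Fin.sum_univ_two, Matrix.vecMul, dotProduct] at this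
    linear_combination this
  have e11 : (l₂ * l₂ - c) * X 1 1 = 0 := by
    have := congr_fun (congr_fun h 1) 1
    simp [Matrix.mul_apply, Fin.sum_univ_two, Matrix.vecMul, dotProduct] at this
    linear_combination this
  rw [Matrix.det_fin_two] at hX
  by_cases hc : c = l₁ * l₂
  · subst hc
    refine ⟨(mul_eq_zero.mp e00).resolve_left ?_, (mul_eq_zero.mp e11).resolve_left ?_⟩
    · rw [← mul_sub]
      exact mul_ne_zero h1 (sub_ne_zero.mpr hne)
    · have e : l₂ * l₂ - l₁ * l₂ = (l₂ - l₁) * l₂ := by ring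
      rw [e]
      exact mul_ne_zero (sub_ne_zero.mpr hne.symm) h2
  · exfalso
    have hlc : l₁ * l₂ - c ≠ 0 := sub_ne_zero.mpr (Ne.symm hc)
    have hx01 : X 0 1 = 0 := (mul_eq_zero.mp e01).resolve_left hlc
    have hx10 : X 1 0 = 0 := (mul_eq_zero.mp e10).resolve_left hlc
    rw [hx01, hx10, zero_mul, sub_zero] at hX
    have h00 : X 0 0 ≠ 0 := left_ne_zero_of_mul hX
    have h11 : X 1 1 ≠ 0 := right_ne_zero_of_mul hX
    have c1 : l₁ * l₁ - c = 0 := (mul_eq_zero.mp e00).resolve_right h00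
    have c2 : l₂ * l₂ - c = 0 := (mul_eq_zero.mp e11).resolve_right h11
    exact hsq (by linear_combination c1 - c2)

/-- Conjugating by `diag(1, t)`. -/
theorem diag_one_conj {t : A} (ht : t ≠ 0) (X : Matrix (Fin 2) (Fin 2) A) :
    !![(1 : A), 0; 0, t⁻¹] * X * !![(1 : A), 0; 0, t] = !![X 0 0, X 0 1 * t; t⁻¹ * X 1 0, X 1 1] := by
  ext i j
  fin_cases i <;> fin_cases j <;> simp [Matrix.mul_apply, Fin.sum_univ_two, Matrix.vecMul, dotProduct]
  rw [mul_comm, ← mul_assoc, mul_inv_cancel₀ ht, one_mul]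

/-- `diag(1, t⁻¹) · diag(1, t) = 1`. -/
theorem diag_one_inv_mul {t : A} (ht : t ≠ 0) :
    !![(1 : A), 0; 0, t⁻¹] * !![(1 : A), 0; 0, t] = 1 := by
  ext i j
  fin_cases i <;> fin_cases j <;> simp [Matrix.mul_apply, Fin.sum_univ_two, ht]

/-- Square roots in an algebraically closed field rescale an antidiagonal matrix to `b·W`. -/
theorem exists_rescale [IsAlgClosed A] {x y : A} (hx : x ≠ 0) (hy : y ≠ 0) :
    ∃ t : A, t ≠ 0 ∧ x * t = t⁻¹ * y := by
  obtain ⟨t, ht⟩ := IsAlgClosed.exists_eq_mul_self (y / x)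
  have ht0 : t ≠ 0 := by
    rintro rfl
    rw [mul_zero, div_eq_zero_iff] at ht
    exact ht.elim hy hx
  refine ⟨t, ht0, ?_⟩
  have hyx : y = x * (t * t) := by rw [← ht]; field_simp
  rw [hyx]
  field_simp

/-- Two of the three equations `l₁ⁱ a + l₂ⁱ b = 0`, `i = 0, 1`. -/
theorem eq_zero_of_pair01 {l₁ l₂ a b : A} (hne : l₁ ≠ l₂) (h0 : a + b = 0)
    (h1 : l₁ * a + l₂ * b = 0) : a = 0 ∧ b = 0 := by
  have hb : (l₂ - l₁) * b = 0 := by linear_combination h1 - l₁ * h0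
  have hb0 : b = 0 := (mul_eq_zero.mp hb).resolve_left (sub_ne_zero.mpr hne.symm)
  exact ⟨by linear_combination h0 - hb0, hb0⟩

/-- Two of the three equations `l₁ⁱ a + l₂ⁱ b = 0`, `i = 0, 2`. -/
theorem eq_zero_of_pair02 {l₁ l₂ a b : A} (hsq : l₁ ^ 2 ≠ l₂ ^ 2) (h0 : a + b = 0)
    (h2 : l₁ ^ 2 * a + l₂ ^ 2 * b = 0) : a = 0 ∧ b = 0 := by
  have hb : (l₂ ^ 2 - l₁ ^ 2) * b = 0 := by linear_combination h2 - l₁ ^ 2 * h0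
  have hb0 : b = 0 := (mul_eq_zero.mp hb).resolve_left (sub_ne_zero.mpr hsq.symm)
  exact ⟨by linear_combination h0 - hb0, hb0⟩

/-- Two of the three equations `l₁ⁱ a + l₂ⁱ b = 0`, `i = 1, 2`. -/
theorem eq_zero_of_pair12 {l₁ l₂ a b : A} (h1' : l₁ ≠ 0) (h2' : l₂ ≠ 0) (hne : l₁ ≠ l₂)
    (h1 : l₁ * a + l₂ * b = 0) (h2 : l₁ ^ 2 * a + l₂ ^ 2 * b = 0) : a = 0 ∧ b = 0 := by
  have hb : (l₂ * (l₂ - l₁)) * b = 0 := by linear_combination h2 - l₁ * h1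
  have hb0 : b = 0 :=
    (mul_eq_zero.mp hb).resolve_left (mul_ne_zero h2' (sub_ne_zero.mpr hne.symm))
  have ha : l₁ * a = 0 := by linear_combination h1 - l₂ * hb0
  exact ⟨(mul_eq_zero.mp ha).resolve_left h1', hb0⟩

/-- **The Vandermonde sign lemma.**  If `l₁ⁱ u + l₂ⁱ v = ± (l₁ⁱ u₀ + l₂ⁱ v₀)` for `i = 0, 1, 2` (signs
depending on `i`), with `l₁, l₂ ≠ 0`, `l₁ ≠ l₂`, `l₁² ≠ l₂²`, then `(u, v) = ± (u₀, v₀)`: two of the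
three signs agree, and the corresponding `2 × 2` system is invertible. -/
theorem sign_lemma {l₁ l₂ u v u₀ v₀ : A} (h1' : l₁ ≠ 0) (h2' : l₂ ≠ 0) (hne : l₁ ≠ l₂)
    (hsq : l₁ ^ 2 ≠ l₂ ^ 2)
    (e0 : u + v = u₀ + v₀ ∨ u + v = -(u₀ + v₀))
    (e1 : l₁ * u + l₂ * v = l₁ * u₀ + l₂ * v₀ ∨ l₁ * u + l₂ * v = -(l₁ * u₀ + l₂ * v₀))
    (e2 : l₁ ^ 2 * u + l₂ ^ 2 * v = l₁ ^ 2 * u₀ + l₂ ^ 2 * v₀ ∨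
      l₁ ^ 2 * u + l₂ ^ 2 * v = -(l₁ ^ 2 * u₀ + l₂ ^ 2 * v₀)) :
    ∃ η : A, (η = 1 ∨ η = -1) ∧ u = η * u₀ ∧ v = η * v₀ := by
  rcases e0 with e0 | e0 <;> rcases e1 with e1 | e1 <;> rcases e2 with e2 | e2
  · obtain ⟨ha, hb⟩ := eq_zero_of_pair01 (a := u - u₀) (b := v - v₀) hne
      (by linear_combination e0) (by linear_combination e1)
    exact ⟨1, Or.inl rfl, by linear_combination ha, by linear_combination hb⟩
  · obtain ⟨ha, hb⟩ := eq_zero_of_pair01 (a := u - u₀) (b := v - v₀) hne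
      (by linear_combination e0) (by linear_combination e1)
    exact ⟨1, Or.inl rfl, by linear_combination ha, by linear_combination hb⟩
  · obtain ⟨ha, hb⟩ := eq_zero_of_pair02 (a := u - u₀) (b := v - v₀) hsq
      (by linear_combination e0) (by linear_combination e2)
    exact ⟨1, Or.inl rfl, by linear_combination ha, by linear_combination hb⟩
  · obtain ⟨ha, hb⟩ := eq_zero_of_pair12 (a := u + u₀) (b := v + v₀) h1' h2' hne
      (by linear_combination e1) (by linear_combination e2)
    exact ⟨-1, Or.inr rfl, by linear_combination ha, by linear_combination hb⟩
  · obtain ⟨ha, hb⟩ := eq_zero_of_pair12 (a := u - u₀) (b := v - v₀) h1' h2' hne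
      (by linear_combination e1) (by linear_combination e2)
    exact ⟨1, Or.inl rfl, by linear_combination ha, by linear_combination hb⟩
  · obtain ⟨ha, hb⟩ := eq_zero_of_pair02 (a := u + u₀) (b := v + v₀) hsq
      (by linear_combination e0) (by linear_combination e2)
    exact ⟨-1, Or.inr rfl, by linear_combination ha, by linear_combination hb⟩
  · obtain ⟨ha, hb⟩ := eq_zero_of_pair01 (a := u + u₀) (b := v + v₀) hne
      (by linear_combination e0) (by linear_combination e1)
    exact ⟨-1, Or.inr rfl, by linear_combination ha, by linear_combination hb⟩
  · obtain ⟨ha, hb⟩ := eq_zero_of_pair01 (a := u + u₀) (b := v + v₀) hne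
      (by linear_combination e0) (by linear_combination e1)
    exact ⟨-1, Or.inr rfl, by linear_combination ha, by linear_combination hb⟩

/-! ### Trace formulas in the normal form -/

/-- `tr (diag(l₁, l₂) Y) = l₁ Y₀₀ + l₂ Y₁₁`. -/
theorem trace_diag_mul (l₁ l₂ : A) (Y : Matrix (Fin 2) (Fin 2) A) :
    (!![l₁, 0; 0, l₂] * Y).trace = l₁ * Y 0 0 + l₂ * Y 1 1 := by
  simp [Matrix.trace_fin_two, Fin.sum_univ_two, Matrix.vecMul, dotProduct]

/-- `tr (b W diag(l₁, l₂) Y) = b (l₁ Y₀₁ + l₂ Y₁₀)`. -/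
theorem trace_antidiag_diag_mul (b l₁ l₂ : A) (Y : Matrix (Fin 2) (Fin 2) A) :
    (!![0, b; b, 0] * !![l₁, 0; 0, l₂] * Y).trace = b * (l₁ * Y 0 1 + l₂ * Y 1 0) := by
  simp [Matrix.trace_fin_two, Fin.sum_univ_two, Matrix.vecMul, dotProduct]
  ring

/-- `diag(l₁, l₂)² = diag(l₁², l₂²)`. -/
theorem diag_mul_diag (l₁ l₂ : A) :
    !![l₁, 0; 0, l₂] * !![l₁, 0; 0, l₂] = !![l₁ ^ 2, 0; 0, l₂ ^ 2] := by
  ext i j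
  fin_cases i <;> fin_cases j <;> simp [Matrix.mul_apply, Fin.sum_univ_two, sq]

/-- `J Z J` for `J = diag(1, -1)` flips the signs of the off-diagonal entries. -/
theorem J_mul_mul_J (Z : Matrix (Fin 2) (Fin 2) A) :
    !![(1 : A), 0; 0, -1] * Z * !![(1 : A), 0; 0, -1] = !![Z 0 0, -Z 0 1; -Z 1 0, Z 1 1] := by
  ext i j
  fin_cases i <;> fin_cases j <;> simp [Matrix.mul_apply, Fin.sum_univ_two, Matrix.vecMul, dotProduct]

/-- `J J = 1`. -/
theorem J_mul_J : !![(1 : A), 0; 0, -1] * !![(1 : A), 0; 0, -1] = 1 := by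
  ext i j
  fin_cases i <;> fin_cases j <;> simp [Matrix.mul_apply, Fin.sum_univ_two]

/-- A scalar multiple of a matrix with non-zero determinant determines the scalar. -/
theorem smul_left_cancel_of_det_ne_zero {a b : A} {M : Matrix (Fin 2) (Fin 2) A}
    (hM : M.det ≠ 0) (h : a • M = b • M) : a = b := by
  have hM0 : M ≠ 0 := by
    rintro rfl
    exact hM Matrix.det_zero
  obtain ⟨i, j, hij⟩ : ∃ i j, M i j ≠ 0 := by
    by_contra hc
    push Not at hc
    exact hM0 (Matrix.ext hc)
  have := congr_fun (congr_fun h i) j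
  simp only [Matrix.smul_apply, smul_eq_mul] at this
  exact mul_right_cancel₀ hij this

/-- `tr (b W Y) = b (Y₀₁ + Y₁₀)`. -/
theorem trace_antidiag_mul (b : A) (Y : Matrix (Fin 2) (Fin 2) A) :
    (!![0, b; b, 0] * Y).trace = b * (Y 0 1 + Y 1 0) := by
  simp [Matrix.trace_fin_two, Fin.sum_univ_two, Matrix.vecMul, dotProduct]
  ring

/-- Powers of `diag(l₁, l₂)`. -/
theorem diag_pow (l₁ l₂ : A) (n : ℕ) : !![l₁, 0; 0, l₂] ^ n = !![l₁ ^ n, 0; 0, l₂ ^ n] := by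
  induction n with
  | zero => rw [pow_zero, pow_zero, pow_zero, Matrix.one_fin_two]
  | succ n ih =>
    rw [pow_succ, ih]
    ext i j
    fin_cases i <;> fin_cases j <;> simp [Matrix.mul_apply, Fin.sum_univ_two, pow_succ]

/-- Powers commute with conjugation: `(P⁻¹ S P)ⁿ = P⁻¹ Sⁿ P`. -/
theorem conj_pow (P : GL (Fin 2) A) (S : Matrix (Fin 2) (Fin 2) A) (n : ℕ) :
    (((P⁻¹ : GL (Fin 2) A) : Matrix (Fin 2) (Fin 2) A) * S * P) ^ n =
      ((P⁻¹ : GL (Fin 2) A) : Matrix (Fin 2) (Fin 2) A) * S ^ n * P := by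
  induction n with
  | zero => rw [pow_zero, pow_zero, Matrix.mul_one, ← Units.val_mul, inv_mul_cancel, Units.val_one]
  | succ n ih =>
    rw [pow_succ, ih, pow_succ]
    simp only [Matrix.mul_assoc]
    rw [← Matrix.mul_assoc (P : Matrix (Fin 2) (Fin 2) A), ← Units.val_mul, mul_inv_cancel,
      Units.val_one, Matrix.one_mul]

/-- Sign cancellation: `c x = ± y` with `c = ± 1` gives `x = ± y`. -/
theorem sign_cancel {c x y : A} (hcc : c = 1 ∨ c = -1) (h : c * x = y ∨ c * x = -y) :
    x = y ∨ x = -y := by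
  rcases hcc with rfl | rfl <;> rcases h with h | h
  · exact Or.inl (by linear_combination h)
  · exact Or.inr (by linear_combination h)
  · exact Or.inr (by linear_combination -h)
  · exact Or.inl (by linear_combination -h)

/-- Sign cancellation with a non-zero factor: `c d x = ± d y`, `c = ± 1`, `d ≠ 0` gives `x = ± y`. -/
theorem sign_cancel_mul {c d x y : A} (hd : d ≠ 0) (hcc : c = 1 ∨ c = -1)
    (h : c * d * x = d * y ∨ c * d * x = -(d * y)) : x = y ∨ x = -y := by
  have h' : c * x = y ∨ c * x = -y := by
    rcases h with h | h
    · exact Or.inl (mul_left_cancel₀ hd (by linear_combination h))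
    · exact Or.inr (mul_left_cancel₀ hd (by linear_combination h))
  exact sign_cancel hcc h'

/-- The centre of `GL₂` consists of scalars (matrix form). -/
theorem exists_smul_one_of_mem_center {x : GL (Fin 2) A}
    (hx : x ∈ Subgroup.center (GL (Fin 2) A)) :
    ∃ c : A, ((x : GL (Fin 2) A) : Matrix (Fin 2) (Fin 2) A) = c • 1 := by
  obtain ⟨c, hc⟩ := Matrix.GeneralLinearGroup.mem_center_iff_val_mem_range_scalar.mp hx
  exact ⟨c, by rw [← hc, Matrix.scalar_apply, Matrix.smul_one_eq_diagonal]⟩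

/-- Scalars are central in `GL₂` (matrix form). -/
theorem mem_center_of_eq_smul_one {x : GL (Fin 2) A} {c : A}
    (hx : ((x : GL (Fin 2) A) : Matrix (Fin 2) (Fin 2) A) = c • 1) :
    x ∈ Subgroup.center (GL (Fin 2) A) := by
  refine Matrix.GeneralLinearGroup.mem_center_iff_val_mem_range_scalar.mpr ⟨c, ?_⟩
  rw [hx, Matrix.scalar_apply, Matrix.smul_one_eq_diagonal]

/-- In a group: `a b a⁻¹ b = z` central gives `b a b = z a`. -/
theorem mul_mul_eq_of_rel {G : Type*} [Group G] {a b z : G} (hz : z ∈ Subgroup.center G)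
    (h : a * b * a⁻¹ * b = z) : b * a * b = z * a := by
  have h1 : a * b = z * b⁻¹ * a := by
    rw [← h]; group
  have hzb : b * z = z * b := ((Subgroup.mem_center_iff.mp hz) b)
  calc b * a * b = b * (a * b) := by group
    _ = b * (z * b⁻¹ * a) := by rw [h1]
    _ = (b * z) * b⁻¹ * a := by group
    _ = z * a := by rw [hzb]; group

/-- Conjugation is multiplicative: `(P⁻¹ X P)(P⁻¹ Y P) = P⁻¹ (X Y) P`. -/
theorem conj_mul (P : GL (Fin 2) A) (X Y : Matrix (Fin 2) (Fin 2) A) :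
    ((P⁻¹ : GL (Fin 2) A) : Matrix (Fin 2) (Fin 2) A) * X * P *
      (((P⁻¹ : GL (Fin 2) A) : Matrix (Fin 2) (Fin 2) A) * Y * P) =
      ((P⁻¹ : GL (Fin 2) A) : Matrix (Fin 2) (Fin 2) A) * (X * Y) * P := by
  simp only [Matrix.mul_assoc]
  rw [← Matrix.mul_assoc (P : Matrix (Fin 2) (Fin 2) A), ← Units.val_mul, mul_inv_cancel,
    Units.val_one, Matrix.one_mul]

end TwistConjugate

open TwistConjugate in
/-- Registered sub-goal of S4b (closed form of `sign_lemma`): the Vandermonde sign lemma. -/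
theorem stub_vandermondeSignLemma :
    ∀ (A : Type v) [Field A] (l₁ l₂ u v u₀ v₀ : A), l₁ ≠ 0 → l₂ ≠ 0 → l₁ ≠ l₂ → l₁ ^ 2 ≠ l₂ ^ 2 → (u + v = u₀ + v₀ ∨ u + v = -(u₀ + v₀)) → (l₁ * u + l₂ * v = l₁ * u₀ + l₂ * v₀ ∨ l₁ * u + l₂ * v = -(l₁ * u₀ + l₂ * v₀)) → (l₁ ^ 2 * u + l₂ ^ 2 * v = l₁ ^ 2 * u₀ + l₂ ^ 2 * v₀ ∨ l₁ ^ 2 * u + l₂ ^ 2 * v = -(l₁ ^ 2 * u₀ + l₂ ^ 2 * v₀)) → ∃ η : A, (η = 1 ∨ η = -1) ∧ u = η * u₀ ∧ v = η * v₀ :=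
  fun _ _ _ _ _ _ _ _ h1 h2 hne hsq e0 e1 e2 => sign_lemma h1 h2 hne hsq e0 e1 e2


end Summit.Langlands.Langlands.Theorems.ArtinWeightRealisationEven
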